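import Literature.NumberTheory.EllipticCurves.SharpFlatPAdicLFunctionCoeffField
import Literature.NumberTheory.EllipticCurves.GreenbergSelmerCharIdealPrincipalProofs
import Literature.NumberTheory.Automorphic.PadicIntermediateFieldUnitBall
import Literature.NumberTheory.NumberFields.RayClassFieldAdicCharacterLocalUnits
import Literature.NumberTheory.GaloisRepresentations.PadicAlgebraOfLocalField
import Literature.NumberTheory.GaloisRepresentations.UnramifiedPeriodMatrix
import HarnessLib

/-!
# Route `SignedLowerHalves`, crux L `SmallImageLowerHalfBothSigns` (stmt-BirchSwinnertonDyer-23599), line `rtt_w3` v12 — row T-2 / J-loc′ of INJ_top: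
# THE COEFFICIENT RING `𝒪_S` IS A FINITE FREE MODULE OVER `𝒪_v` ALONG THE EMBEDDING `ι_v : 𝒪[K_v] → 𝒪_S`

Hand `bsd-inputs-honda-p1` g20 (LEAD `cruxlead-stmt-BirchSwinnertonDyer-23599` g7); helper `--supports stmt-BirchSwinnertonDyer-23599`; THEOREMS ONLY
(no definition, no named fact, no instance, no `sorry`).  BSD / crux L / INJ_top / T-2 are NOT proved here.

For the coordinates `s_i : (F_S/𝒪_S)(θ) → W_K[p^∞]` of T-2 one needs an `𝒪_v`-basis of `𝒪_S = padicCoeffIntegers S` for the module structure given by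
the coefficient embedding `ι_v` of `…RttCharRoadCoeffEmbedding.exists_coeffRingHom` (`v ∣ p`).  This file supplies the algebra:

* `coe_ringHom_padicInt_eq` — a ring homomorphism `ℤ_p → 𝒪_S` is the canonical one (`p`-adic approximation `x ≡ appr x n (mod pⁿ)` and the ultrametric
  inequality: `‖f x − x‖ ≤ p⁻ⁿ` for all `n`); hence `ι_v` restricted to `ℤ_p` is canonical and `𝒪_S` is an `IsScalarTower ℤ_p 𝒪_v 𝒪_S`.
* `injective_coeffRingHom` — a ring homomorphism `ι : 𝒪_v → 𝒪_S` (`𝒪_v = v.adicCompletionIntegers K`, `v ∣ p`) is injective (its kernel is a prime of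
  the DVR `𝒪_v` not containing `p`, as `ι p = p ≠ 0`).
* ★ `moduleFinite_of_coeffRingHom`, ★ `moduleFree_of_coeffRingHom` — `𝒪_S` is a finite free `𝒪_v`-module along `ι` (finite over `ℤ_p` by the tree's
  `PadicIntermediateField.moduleFinite_unitBall` and `padicCoeffIntegers_eq_unitBall`; torsion-free over the PID `𝒪_v`).

References: [NeukirchANT1999] Ch. II (4.8), (6.8); [SerreLocalFields1979] Ch. II §2 Prop. 3.
-/

set_option autoImplicit false
-- D-0017: single-problem summit, the namespace repeats the problem name by design.
set_option linter.dupNamespace false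
noncomputable section

open scoped Classical NumberField Topology
open NumberField IsDedekindDomain IsDedekindDomain.HeightOneSpectrum ValuativeRel
  Literature.NumberTheory.EllipticCurves Literature.NumberTheory.NumberFields
  Literature.NumberTheory.GaloisRepresentations Literature.NumberTheory.GaloisRepresentations.IsNonarchimedeanLocalField
  Literature.NumberTheory.Automorphic

namespace Summit.BirchSwinnertonDyer.BirchSwinnertonDyer.Theorems.SmallImageRttCharRoad

/-! ## §1 Ring homomorphisms `ℤ_p → 𝒪_S` are canonical -/

section PadicInt

variable {p : ℕ} [hp : Fact p.Prime] {S : Set (PadicAlgCl p)}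

/-- **Any ring homomorphism `ℤ_p → 𝒪_S` is the canonical inclusion** (read in `ℚ̄_p`): `x ≡ appr x n (mod pⁿ)` gives
`‖f x − x‖ ≤ p⁻ⁿ` for every `n` by the ultrametric inequality. [cite: NeukirchANT1999, Ch. II (4.8)] -/
theorem coe_ringHom_padicInt_eq (f : ℤ_[p] →+* padicCoeffIntegers S) (x : ℤ_[p]) :
    ((f x : padicCoeffIntegers S) : PadicAlgCl p) = ((x : ℚ_[p]) : PadicAlgCl p) := by
  have hp1 : 1 < (p : ℝ) := by exact_mod_cast hp.out.one_lt
  have hnorm : ‖(p : PadicAlgCl p)‖ = (p : ℝ)⁻¹ := by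
    rw [← map_natCast (algebraMap ℚ_[p] (PadicAlgCl p)) p]
    change ‖((p : ℚ_[p]) : PadicAlgCl p)‖ = _
    rw [PadicAlgCl.norm_extends, Padic.norm_p]
  have key : ∀ n : ℕ, ‖((f x : padicCoeffIntegers S) : PadicAlgCl p) - ((x : ℚ_[p]) : PadicAlgCl p)‖ ≤ ((p : ℝ)⁻¹) ^ n := by
    intro n
    obtain ⟨y, hy⟩ := Ideal.mem_span_singleton'.mp (PadicInt.appr_spec n x)
    have hx : x = (x.appr n : ℤ_[p]) + (p : ℤ_[p]) ^ n * y := by rw [mul_comm, hy]; ring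
    have h1 : ((f x : padicCoeffIntegers S) : PadicAlgCl p) =
        (x.appr n : PadicAlgCl p) + (p : PadicAlgCl p) ^ n * ((f y : padicCoeffIntegers S) : PadicAlgCl p) := by
      conv_lhs => rw [hx]
      rw [map_add, map_mul, map_pow, map_natCast, map_natCast]
      push_cast
      rfl
    have h2 : ((x : ℚ_[p]) : PadicAlgCl p) =
        (x.appr n : PadicAlgCl p) + (p : PadicAlgCl p) ^ n * ((y : ℚ_[p]) : PadicAlgCl p) := by
      conv_lhs => rw [hx]
      push_cast
      ring
    rw [h1, h2, add_sub_add_left_eq_sub, ← mul_sub, norm_mul, norm_pow, hnorm]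
    refine mul_le_of_le_one_right (pow_nonneg (inv_nonneg.mpr (Nat.cast_nonneg p)) n) ?_
    rw [sub_eq_add_neg]
    refine (IsUltrametricDist.norm_add_le_max _ _).trans (max_le (f y).2.2 ?_)
    rw [norm_neg, PadicAlgCl.norm_extends, ← PadicInt.norm_def]
    exact y.norm_le_one
  have hlim : Filter.Tendsto (fun n : ℕ ↦ ((p : ℝ)⁻¹) ^ n) Filter.atTop (𝓝 0) :=
    tendsto_pow_atTop_nhds_zero_of_lt_one (inv_nonneg.mpr (Nat.cast_nonneg p)) (inv_lt_one_of_one_lt₀ hp1)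
  have h0 : ‖((f x : padicCoeffIntegers S) : PadicAlgCl p) - ((x : ℚ_[p]) : PadicAlgCl p)‖ ≤ 0 :=
    ge_of_tendsto' hlim key
  exact sub_eq_zero.mp (norm_le_zero_iff.mp h0)

/-- Two ring homomorphisms `ℤ_p → 𝒪_S` agree. [cite: NeukirchANT1999, Ch. II (4.8)] -/
theorem ringHom_padicInt_ext (f g : ℤ_[p] →+* padicCoeffIntegers S) : f = g :=
  RingHom.ext fun x ↦ Subtype.ext (by rw [coe_ringHom_padicInt_eq, coe_ringHom_padicInt_eq])

end PadicInt

/-! ## §2 `𝒪_S` over `𝒪_v` along a ring homomorphism `ι : 𝒪_v → 𝒪_S` (`v ∣ p`) -/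

section OverOv

variable {K : Type} [Field K] [NumberField K] (v : HeightOneSpectrum (𝓞 K)) {p : ℕ} [hp : Fact p.Prime] {S : Set (PadicAlgCl p)}
  (ι : v.adicCompletionIntegers K →+* padicCoeffIntegers S)

omit hp in
/-- `p` is not a unit of `𝒪_v` when `v ∣ p`. [folklore] -/
theorem natCast_prime_mem_maximalIdeal (hpv : ((p : ℕ) : 𝓞 K) ∈ v.asIdeal) :
    ((p : ℕ) : v.adicCompletionIntegers K) ∈ IsLocalRing.maximalIdeal (v.adicCompletionIntegers K) := by
  rw [IsLocalRing.mem_maximalIdeal, mem_nonunits_iff]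
  have hint : Valued.v.Integers (v.adicCompletionIntegers K) := Valuation.valuationSubring.integers _
  rw [hint.isUnit_iff_valuation_eq_one]
  have hlt : Valued.v (((p : ℕ) : v.adicCompletionIntegers K) : v.adicCompletion K) < 1 := by
    have h0 : (((p : ℕ) : v.adicCompletionIntegers K) : v.adicCompletion K) = ((p : ℕ) : v.adicCompletion K) := by norm_cast
    have h1 : ((p : ℕ) : v.adicCompletion K) = ((algebraMap (𝓞 K) K p : K) : v.adicCompletion K) := by
      rw [← map_natCast (algebraMap (𝓞 K) (v.adicCompletion K)) p]
      rfl
    rw [h0, h1, HeightOneSpectrum.adicCompletion.valued_coe]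
    exact (v.valuation_lt_one_iff_mem _).2 hpv
  exact ne_of_lt hlt

include hp in
/-- **A ring homomorphism `ι : 𝒪_v → 𝒪_S` (`v ∣ p`) is injective**: its kernel is a prime ideal of the DVR `𝒪_v`, and it is not the maximal ideal
because `ι p = p ≠ 0`; hence it is `⊥`. [cite: NeukirchANT1999, Ch. II (4.8)] -/
theorem injective_coeffRingHom (hpv : ((p : ℕ) : 𝓞 K) ∈ v.asIdeal) : Function.Injective ι := by
  rw [injective_iff_map_eq_zero]
  intro a ha
  by_contra ha0
  haveI : (RingHom.ker ι).IsPrime := RingHom.ker_isPrime ι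
  have hne : RingHom.ker ι ≠ ⊥ := fun h ↦ ha0 (by
    have : a ∈ RingHom.ker ι := ha
    rw [h, Ideal.mem_bot] at this
    exact this)
  have hmax : RingHom.ker ι = IsLocalRing.maximalIdeal (v.adicCompletionIntegers K) :=
    (IsLocalRing.eq_maximalIdeal (Ideal.IsPrime.isMaximal inferInstance hne))
  have hpker : ((p : ℕ) : v.adicCompletionIntegers K) ∈ RingHom.ker ι := by
    rw [hmax]; exact natCast_prime_mem_maximalIdeal v hpv
  rw [RingHom.mem_ker, map_natCast] at hpker
  have h := congrArg (fun z : padicCoeffIntegers S ↦ (z : PadicAlgCl p)) hpker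
  push_cast at h
  exact hp.out.ne_zero (by exact_mod_cast h)

/-- `𝒪_S` is module-finite over `ℤ_p` for the algebra structure `padicIntToCoeffIntegers` (transport of the tree's
`PadicIntermediateField.moduleFinite_unitBall` along `padicCoeffIntegers_eq_unitBall`). [cite: NeukirchANT1999, Ch. II (6.8)] -/
theorem moduleFinite_padicInt_padicCoeffIntegers [FiniteDimensional ℚ_[p] (padicCoeffField S)] :
    letI := (padicIntToCoeffIntegers S).toAlgebra
    Module.Finite ℤ_[p] (padicCoeffIntegers S) := by
  letI := (padicIntToCoeffIntegers S).toAlgebra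
  have heq := padicCoeffIntegers_eq_unitBall S
  -- the `ℤ_p`-linear isomorphism `unitBall ≃ 𝒪_S` (same underlying set)
  let e : PadicIntermediateField.unitBall p (padicCoeffField S) ≃ₗ[ℤ_[p]] padicCoeffIntegers S :=
    { toFun := fun x ↦ ⟨x.1, by rw [heq]; exact x.2⟩
      invFun := fun y ↦ ⟨y.1, by rw [← heq]; exact y.2⟩
      left_inv := fun x ↦ rfl
      right_inv := fun y ↦ rfl
      map_add' := fun x y ↦ rfl
      map_smul' := fun z x ↦ Subtype.ext (by
        change ((z • x : PadicIntermediateField.unitBall p (padicCoeffField S)) : PadicAlgCl p) =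
          ((padicIntToCoeffIntegers S z : padicCoeffIntegers S) : PadicAlgCl p) * (x : PadicAlgCl p)
        rw [Algebra.smul_def, Subring.coe_mul, coe_padicIntToCoeffIntegers]
        rfl) }
  exact Module.Finite.equiv e

include hp in
/-- ★ **`𝒪_S` is module-finite over `𝒪_v` along `ι`** (`v ∣ p`): `ι ∘ (ℤ_p → 𝒪_v) = (ℤ_p → 𝒪_S)` (`ringHom_padicInt_ext`) makes `𝒪_S` a scalar tower
over `ℤ_p ⊆ 𝒪_v`, and `𝒪_S` is already finite over `ℤ_p`. [cite: NeukirchANT1999, Ch. II (6.8)] -/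
theorem moduleFinite_of_coeffRingHom [FiniteDimensional ℚ_[p] (padicCoeffField S)] (hpv : ((p : ℕ) : 𝓞 K) ∈ v.asIdeal) :
    letI := ι.toAlgebra
    Module.Finite (v.adicCompletionIntegers K) (padicCoeffIntegers S) := by
  letI := ι.toAlgebra
  letI : Algebra ℚ_[p] (v.adicCompletion K) := LocalField.adicCompletionPadicAlgebra v p hpv
  -- `ℤ_p → 𝒪_v`
  let jp : ℤ_[p] →+* v.adicCompletionIntegers K :=
    ((integerEquivAdicCompletionIntegers v : 𝒪[v.adicCompletion K] ≃+* v.adicCompletionIntegers K) :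
      𝒪[v.adicCompletion K] →+* v.adicCompletionIntegers K).comp (padicIntToInteger (v.adicCompletion K) p)
  letI : Algebra ℤ_[p] (v.adicCompletionIntegers K) := jp.toAlgebra
  letI : Algebra ℤ_[p] (padicCoeffIntegers S) := (padicIntToCoeffIntegers S).toAlgebra
  haveI : IsScalarTower ℤ_[p] (v.adicCompletionIntegers K) (padicCoeffIntegers S) :=
    IsScalarTower.of_algebraMap_eq fun z ↦ by
      change padicIntToCoeffIntegers S z = ι (jp z)
      exact congrFun (congrArg DFunLike.coe (ringHom_padicInt_ext (padicIntToCoeffIntegers S) (ι.comp jp))) z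
  haveI := moduleFinite_padicInt_padicCoeffIntegers (S := S)
  exact Module.Finite.of_restrictScalars_finite ℤ_[p] (v.adicCompletionIntegers K) (padicCoeffIntegers S)

include hp in
/-- ★ **`𝒪_S` is a free `𝒪_v`-module along `ι`** (finite and torsion-free over the principal ideal domain `𝒪_v`; `ι` injective).
[cite: NeukirchANT1999, Ch. II (6.8)] -/
theorem moduleFree_of_coeffRingHom [FiniteDimensional ℚ_[p] (padicCoeffField S)] (hpv : ((p : ℕ) : 𝓞 K) ∈ v.asIdeal) :
    letI := ι.toAlgebra
    Module.Free (v.adicCompletionIntegers K) (padicCoeffIntegers S) := by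
  letI := ι.toAlgebra
  haveI := moduleFinite_of_coeffRingHom v ι hpv
  haveI : FaithfulSMul (v.adicCompletionIntegers K) (padicCoeffIntegers S) :=
    (faithfulSMul_iff_algebraMap_injective _ _).2 (injective_coeffRingHom v ι hpv)
  haveI : Module.IsTorsionFree (v.adicCompletionIntegers K) (padicCoeffIntegers S) := inferInstance
  exact Module.free_of_finite_type_torsion_free'

end OverOv

end Summit.BirchSwinnertonDyer.BirchSwinnertonDyer.Theorems.SmallImageRttCharRoad

end
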